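import Summits.NavierStokesRegularity.NavierStokesRegularity.Theorems.LerayQuarterDissipationFiniteDissipationLiouvilleTraceRotational
import HarnessLib

/-!
# Crux `FiniteDissipationLiouville` (stmt-NavierStokesRegularity-22144): the FINAL-TIME VORTICITY of
# a singular member SATURATES THE CRITICAL SCALE `‖x‖⁻²` at the apex and at infinity — one-scale
# ε-regularity by the weighted smallness of the trace's vorticity, thresholds depending on `(C, K)`

Theorems file of route `LerayQuarterDissipation` (lead prover g6; `--supports` the crux; portrait
fact for the registered stub `stub_envelopeCriticalLiouville` of skeleton v9; quantitative form of
the rotational-trace leaves `…TraceRotational`). Navier–Stokes regularity is NOT proved by anything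
here; no summit is.

`𝒟_{C,K}`: Type-I ancient mild fields `u` (`IsTypeIAncientMild C u`) with the quarter-rate law;
`T_u(ψ) = lim_{t→0⁻} ∫⟪u(t), ψ⟫` the distributional trace at the singular time (lead g3). The
distributional VORTICITY of the trace is `ψ ↦ T_u(∇ ∧ ψ)`. For the envelope class
(`‖u₀(x)‖ ≤ A/‖x‖`, all derivatives with the scale-invariant weights for the critical element)
the final-time vorticity is `O(‖x‖⁻²)`; the dual weighted norm `∫ ‖ψ(x)‖/‖x‖² dx` is critical:
`T_{u_λ}(∇ ∧ ψ) = λ⁻¹ T_u(∇ ∧ ψ(λ⁻¹·))` (`integral_pairing_curl_nsRescale`) and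
`∫ ‖ψ(λ⁻¹x)‖/‖x‖² dx = λ ∫ ‖ψ‖/‖x‖²`. Compactness across members (ns-lqd-p1) then gives:

* `exists_trace_vorticity_theta_apex` — **for all `C, K` there is `θ₃ = θ₃(C,K) > 0` such that
  every member whose trace satisfies `|T_u(∇ ∧ ψ)| ≤ θ₃ ∫ ‖ψ(x)‖/‖x‖² dx` for all test fields `ψ`
  supported in ONE ball `B(0, ρ)` is regular at the apex** (for a trace whose vorticity is a
  function: `‖x‖² ‖(∇ ∧ u₀)(x)‖ ≤ θ₃` a.e. near the apex ⇒ regular). Proof: rescale `ρ` to `1`;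
  a singular KNSS limit of singular members with thresholds `1/(k+1)` has trace IRROTATIONAL on
  `B(0,1)`, hence is regular by `not_singular_of_trace_irrotational_near_apex` (`…TraceRotational`):
  contradiction with persistence.
* `exists_trace_vorticity_theta_atInfinity` — the same OUTSIDE ONE BALL, threshold `θ₄(C,K)`
  (the singular limit has trace irrotational outside the closed unit ball, hence vanishes by
  `eq_zero_of_trace_irrotational_farField`).
* PORTRAIT (`trace_vorticity_apex_floor_of_singular`, `trace_vorticity_farField_floor_of_singular`):
  **the final-time vorticity of a SINGULAR member of `𝒟_{C,K}` is NOT dominated by `θ₃/‖x‖²` on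
  any ball around the apex, nor by `θ₄/‖x‖²` outside any ball** — it saturates the `‖x‖⁻²` law of
  the (discretely) homogeneous DSS vorticity, uniformly on the stratum, for the wandering members
  too. `finiteDissipationLiouville_iff_vorticityFloors`: the crux ⟺ its restriction to such members.

HONEST FRAMING: `θ₃, θ₄` come from compactness, not explicit; portrait facts, no DSS scenario of
the catalogued wall is removed.

References: Escauriaza–Seregin–Šverák, Russ. Math. Surveys 58 (2003), Thm. 5.1;
Koch–Nadirashvili–Seregin–Šverák, Acta Math. 203 (2009), §4; Caffarelli–Kohn–Nirenberg 1982.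
-/

noncomputable section

-- the summit and its single sub-problem share the name (CONVENTIONS §1), as in every Theorems file
set_option linter.dupNamespace false

namespace Summit.NavierStokesRegularity.NavierStokesRegularity.Theorems.FiniteDissipationLiouville.Birth.Apex

open MeasureTheory Set Filter Topology Metric Function TopologicalSpace
open Literature.Analysis Literature.Analysis.FluidPDE
open scoped ENNReal NNReal RealInnerProductSpace

variable {C K : ℝ} {u : ℝ → EuclideanSpace ℝ (Fin 3) → EuclideanSpace ℝ (Fin 3)}

/-! ### Scale invariance of the weighted vorticity smallness of the trace -/

/-- **The weighted `L¹` norm with weight `‖x‖⁻²` scales like a length**: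
`∫ ‖ψ(λ⁻¹ • x)‖/‖x‖² dx = λ ∫ ‖ψ(x)‖/‖x‖² dx` for `λ > 0`. -/
theorem integral_norm_div_normsq_comp_inv_smul
    (ψ : EuclideanSpace ℝ (Fin 3) → EuclideanSpace ℝ (Fin 3)) {lam : ℝ} (hlam : 0 < lam) :
    ∫ x, ‖ψ (lam⁻¹ • x)‖ / ‖x‖ ^ 2 = lam * ∫ x, ‖ψ x‖ / ‖x‖ ^ 2 := by
  have h := integral_comp_inv_smul_eq (g := fun x => ‖ψ x‖ / ‖x‖ ^ 2) hlam
  have e : (fun x : EuclideanSpace ℝ (Fin 3) => ‖ψ (lam⁻¹ • x)‖ / ‖lam⁻¹ • x‖ ^ 2) =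
      fun x => lam ^ 2 * (‖ψ (lam⁻¹ • x)‖ / ‖x‖ ^ 2) := by
    funext x
    rw [norm_smul, norm_inv, Real.norm_of_nonneg hlam.le]
    by_cases hx : ‖x‖ = 0
    · simp [hx]
    · field_simp
  simp only [e, integral_const_mul] at h
  have hl : lam ≠ 0 := hlam.ne'
  have hl2 : lam ^ 2 ≠ 0 := pow_ne_zero 2 hl
  calc ∫ x, ‖ψ (lam⁻¹ • x)‖ / ‖x‖ ^ 2
      = (lam ^ 2)⁻¹ * (lam ^ 2 * ∫ x, ‖ψ (lam⁻¹ • x)‖ / ‖x‖ ^ 2) := by field_simp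
    _ = (lam ^ 2)⁻¹ * (lam ^ 3 * ∫ x, ‖ψ x‖ / ‖x‖ ^ 2) := by rw [h]
    _ = lam * ∫ x, ‖ψ x‖ / ‖x‖ ^ 2 := by field_simp

/-- **Trace values of the vorticity under the dilation**: if `T` is the trace value of
`u_λ = nsRescale λ u` against `∇ ∧ ψ` and `T'` that of `u` against `∇ ∧ ψ(λ⁻¹·)`, then
`T = λ⁻¹ T'`. -/
theorem trace_curl_nsRescale_eq (hu : IsTypeIAncientMild C u)
    (hlaw : ∀ s : ℝ, s < 0 → ∫⁻ x, ‖fderiv ℝ (u s) x‖ₑ ^ 2 ≤ ENNReal.ofReal (K / Real.sqrt (-s)))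
    {lam : ℝ} (hlam : 0 < lam) {ψ : EuclideanSpace ℝ (Fin 3) → EuclideanSpace ℝ (Fin 3)}
    (hψ : FunctionSpaces.IsTestFunctionOn (⊤ : Opens (EuclideanSpace ℝ (Fin 3))) ψ) {T : ℝ}
    (hT : Tendsto (fun t => ∫ x, ⟪nsRescale lam u t x, curl ψ x⟫) (𝓝[<] 0) (𝓝 T)) :
    ∃ T' : ℝ, Tendsto (fun t => ∫ x, ⟪u t x, curl (fun y => ψ (lam⁻¹ • y)) x⟫) (𝓝[<] 0) (𝓝 T') ∧
      T = lam⁻¹ * T' := by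
  have hψl : FunctionSpaces.IsTestFunctionOn (⊤ : Opens (EuclideanSpace ℝ (Fin 3)))
      (fun y => ψ (lam⁻¹ • y)) := hψ.comp_smul_top (inv_ne_zero hlam.ne')
  have hψl1 : ContDiff ℝ ((⊤ : ℕ∞) + 1) (fun y => ψ (lam⁻¹ • y)) := by simpa using hψl.contDiff
  have hcψl : FunctionSpaces.IsTestFunctionOn (⊤ : Opens (EuclideanSpace ℝ (Fin 3)))
      (curl (fun y => ψ (lam⁻¹ • y))) :=
    ⟨contDiff_curl hψl1, hasCompactSupport_curl hψl.hasCompactSupport, fun y _ => Opens.mem_top y⟩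
  obtain ⟨T', hT'⟩ := exists_tendsto_pairing_finalSlice hu hlaw hcψl
  refine ⟨T', hT', ?_⟩
  have h := (hT'.comp (tendsto_mul_sq_nhdsWithin_zero hlam)).const_mul lam⁻¹
  have h' : Tendsto (fun t => ∫ x, ⟪nsRescale lam u t x, curl ψ x⟫) (𝓝[<] 0) (𝓝 (lam⁻¹ * T')) :=
    h.congr fun t => (integral_pairing_curl_nsRescale u hlam ψ t).symm
  exact tendsto_nhds_unique hT h'

/-- **The weighted vorticity smallness of the trace on a ball is dilation invariant
(normalisation to the unit ball).** -/
theorem trace_curlSmall_ball_nsRescale (hu : IsTypeIAncientMild C u)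
    (hlaw : ∀ s : ℝ, s < 0 → ∫⁻ x, ‖fderiv ℝ (u s) x‖ₑ ^ 2 ≤ ENNReal.ofReal (K / Real.sqrt (-s)))
    {ρ θ : ℝ} (hρ : 0 < ρ)
    (hsmall : ∀ ψ : EuclideanSpace ℝ (Fin 3) → EuclideanSpace ℝ (Fin 3),
      FunctionSpaces.IsTestFunctionOn (⊤ : Opens (EuclideanSpace ℝ (Fin 3))) ψ →
      (∀ x, ψ x ≠ 0 → ‖x‖ < ρ) →
      ∀ T : ℝ, Tendsto (fun t => ∫ x, ⟪u t x, curl ψ x⟫) (𝓝[<] 0) (𝓝 T) →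
        |T| ≤ θ * ∫ x, ‖ψ x‖ / ‖x‖ ^ 2) :
    ∀ ψ : EuclideanSpace ℝ (Fin 3) → EuclideanSpace ℝ (Fin 3),
      FunctionSpaces.IsTestFunctionOn (⊤ : Opens (EuclideanSpace ℝ (Fin 3))) ψ →
      (∀ x, ψ x ≠ 0 → ‖x‖ < 1) →
      ∀ T : ℝ, Tendsto (fun t => ∫ x, ⟪nsRescale ρ u t x, curl ψ x⟫) (𝓝[<] 0) (𝓝 T) →
        |T| ≤ θ * ∫ x, ‖ψ x‖ / ‖x‖ ^ 2 := by
  intro ψ hψ hsupp T hT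
  obtain ⟨T', hT', hTeq⟩ := trace_curl_nsRescale_eq hu hlaw hρ hψ hT
  have hsupp' : ∀ x, ψ (ρ⁻¹ • x) ≠ 0 → ‖x‖ < ρ := fun x hx => by
    have h := support_comp_inv_smul hρ hsupp x hx
    rwa [mul_one] at h
  have h := hsmall _ (hψ.comp_smul_top (inv_ne_zero hρ.ne')) hsupp' T' hT'
  rw [integral_norm_div_normsq_comp_inv_smul ψ hρ] at h
  rw [hTeq, abs_mul, abs_of_pos (inv_pos.2 hρ)]
  calc ρ⁻¹ * |T'| ≤ ρ⁻¹ * (θ * (ρ * ∫ x, ‖ψ x‖ / ‖x‖ ^ 2)) :=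
        mul_le_mul_of_nonneg_left h (inv_nonneg.2 hρ.le)
    _ = θ * ∫ x, ‖ψ x‖ / ‖x‖ ^ 2 := by field_simp

/-- **The weighted vorticity smallness of the trace outside a ball is dilation invariant
(normalisation to the unit ball).** -/
theorem trace_curlSmall_farField_nsRescale (hu : IsTypeIAncientMild C u)
    (hlaw : ∀ s : ℝ, s < 0 → ∫⁻ x, ‖fderiv ℝ (u s) x‖ₑ ^ 2 ≤ ENNReal.ofReal (K / Real.sqrt (-s)))
    {R θ : ℝ} (hR : 0 < R)
    (hsmall : ∀ ψ : EuclideanSpace ℝ (Fin 3) → EuclideanSpace ℝ (Fin 3),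
      FunctionSpaces.IsTestFunctionOn (⊤ : Opens (EuclideanSpace ℝ (Fin 3))) ψ →
      (∀ x, ψ x ≠ 0 → R < ‖x‖) →
      ∀ T : ℝ, Tendsto (fun t => ∫ x, ⟪u t x, curl ψ x⟫) (𝓝[<] 0) (𝓝 T) →
        |T| ≤ θ * ∫ x, ‖ψ x‖ / ‖x‖ ^ 2) :
    ∀ ψ : EuclideanSpace ℝ (Fin 3) → EuclideanSpace ℝ (Fin 3),
      FunctionSpaces.IsTestFunctionOn (⊤ : Opens (EuclideanSpace ℝ (Fin 3))) ψ →
      (∀ x, ψ x ≠ 0 → 1 < ‖x‖) →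
      ∀ T : ℝ, Tendsto (fun t => ∫ x, ⟪nsRescale R u t x, curl ψ x⟫) (𝓝[<] 0) (𝓝 T) →
        |T| ≤ θ * ∫ x, ‖ψ x‖ / ‖x‖ ^ 2 := by
  intro ψ hψ hsupp T hT
  obtain ⟨T', hT', hTeq⟩ := trace_curl_nsRescale_eq hu hlaw hR hψ hT
  have hsupp' : ∀ x, ψ (R⁻¹ • x) ≠ 0 → R < ‖x‖ := fun x hx => by
    have h := hsupp _ hx
    rw [norm_smul, norm_inv, Real.norm_of_nonneg hR.le] at h
    rwa [lt_inv_mul_iff₀ hR, mul_one] at h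
  have h := hsmall _ (hψ.comp_smul_top (inv_ne_zero hR.ne')) hsupp' T' hT'
  rw [integral_norm_div_normsq_comp_inv_smul ψ hR] at h
  rw [hTeq, abs_mul, abs_of_pos (inv_pos.2 hR)]
  calc R⁻¹ * |T'| ≤ R⁻¹ * (θ * (R * ∫ x, ‖ψ x‖ / ‖x‖ ^ 2)) :=
        mul_le_mul_of_nonneg_left h (inv_nonneg.2 hR.le)
    _ = θ * ∫ x, ‖ψ x‖ / ‖x‖ ^ 2 := by field_simp

/-! ### One-scale ε-regularity by the weighted vorticity of the final datum -/

/-- **ONE-SCALE ε-REGULARITY BY THE VORTICITY OF THE FINAL DATUM AT THE APEX, threshold depending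
on `(C, K)` only.** For all `C, K` there is `θ₃ > 0` such that: if `u ∈ 𝒟_{C,K}` and, for SOME
`ρ > 0`, every test field `ψ` supported in `B(0, ρ)` has `|T_u(∇ ∧ ψ)| ≤ θ₃ ∫ ‖ψ(x)‖/‖x‖² dx`,
then `u` is NOT singular at the apex. -/
theorem exists_trace_vorticity_theta_apex (C K : ℝ) : ∃ θ₃ > 0,
    ∀ (u : ℝ → EuclideanSpace ℝ (Fin 3) → EuclideanSpace ℝ (Fin 3)),
      IsTypeIAncientMild C u →
      (∀ s : ℝ, s < 0 → ∫⁻ x, ‖fderiv ℝ (u s) x‖ₑ ^ 2 ≤ ENNReal.ofReal (K / Real.sqrt (-s))) →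
      ∀ ρ > 0,
      (∀ ψ : EuclideanSpace ℝ (Fin 3) → EuclideanSpace ℝ (Fin 3),
        FunctionSpaces.IsTestFunctionOn (⊤ : Opens (EuclideanSpace ℝ (Fin 3))) ψ →
        (∀ x, ψ x ≠ 0 → ‖x‖ < ρ) →
        ∀ T : ℝ, Tendsto (fun t => ∫ x, ⟪u t x, curl ψ x⟫) (𝓝[<] 0) (𝓝 T) →
          |T| ≤ θ₃ * ∫ x, ‖ψ x‖ / ‖x‖ ^ 2) →
      ¬ (∀ r > 0, ∀ M : ℝ, ∃ t ∈ Set.Ioo (-(r ^ 2)) (0 : ℝ),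
          ∃ x ∈ Metric.ball (0 : EuclideanSpace ℝ (Fin 3)) r, M < ‖u t x‖) := by
  by_contra hcon
  push Not at hcon
  -- ### a sequence of singular members, vorticity-small at one scale with threshold `1/(k+1)`
  have hseq : ∀ k : ℕ, ∃ (v : ℝ → EuclideanSpace ℝ (Fin 3) → EuclideanSpace ℝ (Fin 3)),
      IsTypeIAncientMild C v ∧
      (∀ s : ℝ, s < 0 → ∫⁻ x, ‖fderiv ℝ (v s) x‖ₑ ^ 2 ≤ ENNReal.ofReal (K / Real.sqrt (-s))) ∧
      (∀ ψ : EuclideanSpace ℝ (Fin 3) → EuclideanSpace ℝ (Fin 3),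
        FunctionSpaces.IsTestFunctionOn (⊤ : Opens (EuclideanSpace ℝ (Fin 3))) ψ →
        (∀ x, ψ x ≠ 0 → ‖x‖ < 1) →
        ∀ T : ℝ, Tendsto (fun t => ∫ x, ⟪v t x, curl ψ x⟫) (𝓝[<] 0) (𝓝 T) →
          |T| ≤ 1 / ((k : ℝ) + 1) * ∫ x, ‖ψ x‖ / ‖x‖ ^ 2) ∧
      (∀ r > 0, ∀ M : ℝ, ∃ t ∈ Set.Ioo (-(r ^ 2)) (0 : ℝ),
          ∃ x ∈ Metric.ball (0 : EuclideanSpace ℝ (Fin 3)) r, M < ‖v t x‖) := by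
    intro k
    obtain ⟨u, hu, hlaw, ρ, hρ, hsmall, hsing⟩ := hcon (1 / ((k : ℝ) + 1)) (by positivity)
    exact ⟨nsRescale ρ u, hu.nsRescale hρ, RecurrentReductionD.dissipationLaw_nsRescale hlaw hρ,
      trace_curlSmall_ball_nsRescale hu hlaw hρ hsmall,
      RecurrentReductionD.singularAtOrigin_nsRescale hsing hρ⟩
  choose v hv hvlaw hvsmall hvsing using hseq
  -- ### KNSS compactness across members: a singular limit member `W ∈ 𝒟_{C,K}`
  obtain ⟨ψs, hψs, W, hW, hunif, hpt, hgrad⟩ := Compactness.seqLimit hv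
  have hψt : Tendsto ψs atTop atTop := hψs.tendsto_atTop
  have hWlaw : ∀ s : ℝ, s < 0 →
      ∫⁻ x, ‖fderiv ℝ (W s) x‖ₑ ^ 2 ≤ ENNReal.ofReal (K / Real.sqrt (-s)) :=
    Compactness.law_of_seqLimit (Kinf := K) (Kk := fun _ => K) hψt hvlaw
      (fun ε hε => Eventually.of_forall fun _ => by linarith) hgrad
  have hWsing := Compactness.persistent_singularity_seq (w := fun j => v (ψs j))
    (fun j => hv (ψs j)) (fun j => hvlaw (ψs j)) (fun j => hvsing (ψs j)) hW hunif
  -- ### the trace of `W` is irrotational on `B(0, 1)`, a fortiori on `B(0,1) ∖ {0}`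
  refine not_singular_of_trace_irrotational_near_apex hW hWlaw one_pos (fun φ hφ hsupp => ?_) hWsing
  have hφ1 : ContDiff ℝ ((⊤ : ℕ∞) + 1) φ := by simpa using hφ.contDiff
  have hcφ : FunctionSpaces.IsTestFunctionOn (⊤ : Opens (EuclideanSpace ℝ (Fin 3))) (curl φ) :=
    ⟨contDiff_curl hφ1, hasCompactSupport_curl hφ.hasCompactSupport, fun y _ => Opens.mem_top y⟩
  obtain ⟨L, hL⟩ := exists_tendsto_pairing_finalSlice hW hWlaw hcφ
  suffices hL0 : L = 0 by rwa [hL0] at hL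
  have hsupp1 : ∀ x, φ x ≠ 0 → ‖x‖ < 1 := fun x hx => (hsupp x hx).2
  have hex : ∀ j, ∃ Tj : ℝ, Tendsto (fun t => ∫ x, ⟪v (ψs j) t x, curl φ x⟫) (𝓝[<] 0) (𝓝 Tj) :=
    fun j => exists_tendsto_pairing_finalSlice (hv (ψs j)) (hvlaw (ψs j)) hcφ
  choose Tj hTj using hex
  have hconv : Tendsto Tj atTop (𝓝 L) :=
    tendsto_trace_of_tendsto_slices hcφ (fun j => hv (ψs j)) (fun j => hvlaw (ψs j)) hW hWlaw
      (fun t ht x => hpt t ht x) hTj hL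
  set I : ℝ := ∫ x, ‖φ x‖ / ‖x‖ ^ 2 with hI
  have hbound : ∀ j, |Tj j| ≤ 1 / ((ψs j : ℝ) + 1) * I := fun j =>
    hvsmall (ψs j) φ hφ hsupp1 (Tj j) (hTj j)
  have hzero : Tendsto Tj atTop (𝓝 0) := by
    have hmaj : Tendsto (fun j => 1 / ((ψs j : ℝ) + 1) * I) atTop (𝓝 0) := by
      have h1 : Tendsto (fun j => 1 / ((ψs j : ℝ) + 1)) atTop (𝓝 0) := by
        have h2 : Tendsto (fun j => (ψs j : ℝ) + 1) atTop atTop :=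
          tendsto_atTop_add_const_right _ _ (tendsto_natCast_atTop_atTop.comp hψt)
        exact tendsto_const_nhds.div_atTop h2
      simpa using h1.mul_const I
    exact squeeze_zero_norm (fun j => by rw [Real.norm_eq_abs]; exact hbound j) hmaj
  exact tendsto_nhds_unique hconv hzero

/-- **ONE-SCALE ε-REGULARITY BY THE VORTICITY OF THE FINAL DATUM FROM SPATIAL INFINITY, threshold
depending on `(C, K)` only.** For all `C, K` there is `θ₄ > 0` such that: if `u ∈ 𝒟_{C,K}` and,
for SOME `R > 0`, every test field `ψ` supported in `{‖x‖ > R}` has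
`|T_u(∇ ∧ ψ)| ≤ θ₄ ∫ ‖ψ(x)‖/‖x‖² dx`, then `u` is NOT singular at the apex. -/
theorem exists_trace_vorticity_theta_atInfinity (C K : ℝ) : ∃ θ₄ > 0,
    ∀ (u : ℝ → EuclideanSpace ℝ (Fin 3) → EuclideanSpace ℝ (Fin 3)),
      IsTypeIAncientMild C u →
      (∀ s : ℝ, s < 0 → ∫⁻ x, ‖fderiv ℝ (u s) x‖ₑ ^ 2 ≤ ENNReal.ofReal (K / Real.sqrt (-s))) →
      ∀ R > 0,
      (∀ ψ : EuclideanSpace ℝ (Fin 3) → EuclideanSpace ℝ (Fin 3),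
        FunctionSpaces.IsTestFunctionOn (⊤ : Opens (EuclideanSpace ℝ (Fin 3))) ψ →
        (∀ x, ψ x ≠ 0 → R < ‖x‖) →
        ∀ T : ℝ, Tendsto (fun t => ∫ x, ⟪u t x, curl ψ x⟫) (𝓝[<] 0) (𝓝 T) →
          |T| ≤ θ₄ * ∫ x, ‖ψ x‖ / ‖x‖ ^ 2) →
      ¬ (∀ r > 0, ∀ M : ℝ, ∃ t ∈ Set.Ioo (-(r ^ 2)) (0 : ℝ),
          ∃ x ∈ Metric.ball (0 : EuclideanSpace ℝ (Fin 3)) r, M < ‖u t x‖) := by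
  by_contra hcon
  push Not at hcon
  have hseq : ∀ k : ℕ, ∃ (v : ℝ → EuclideanSpace ℝ (Fin 3) → EuclideanSpace ℝ (Fin 3)),
      IsTypeIAncientMild C v ∧
      (∀ s : ℝ, s < 0 → ∫⁻ x, ‖fderiv ℝ (v s) x‖ₑ ^ 2 ≤ ENNReal.ofReal (K / Real.sqrt (-s))) ∧
      (∀ ψ : EuclideanSpace ℝ (Fin 3) → EuclideanSpace ℝ (Fin 3),
        FunctionSpaces.IsTestFunctionOn (⊤ : Opens (EuclideanSpace ℝ (Fin 3))) ψ →
        (∀ x, ψ x ≠ 0 → 1 < ‖x‖) →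
        ∀ T : ℝ, Tendsto (fun t => ∫ x, ⟪v t x, curl ψ x⟫) (𝓝[<] 0) (𝓝 T) →
          |T| ≤ 1 / ((k : ℝ) + 1) * ∫ x, ‖ψ x‖ / ‖x‖ ^ 2) ∧
      (∀ r > 0, ∀ M : ℝ, ∃ t ∈ Set.Ioo (-(r ^ 2)) (0 : ℝ),
          ∃ x ∈ Metric.ball (0 : EuclideanSpace ℝ (Fin 3)) r, M < ‖v t x‖) := by
    intro k
    obtain ⟨u, hu, hlaw, R, hR, hsmall, hsing⟩ := hcon (1 / ((k : ℝ) + 1)) (by positivity)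
    exact ⟨nsRescale R u, hu.nsRescale hR, RecurrentReductionD.dissipationLaw_nsRescale hlaw hR,
      trace_curlSmall_farField_nsRescale hu hlaw hR hsmall,
      RecurrentReductionD.singularAtOrigin_nsRescale hsing hR⟩
  choose v hv hvlaw hvsmall hvsing using hseq
  obtain ⟨ψs, hψs, W, hW, hunif, hpt, hgrad⟩ := Compactness.seqLimit hv
  have hψt : Tendsto ψs atTop atTop := hψs.tendsto_atTop
  have hWlaw : ∀ s : ℝ, s < 0 →
      ∫⁻ x, ‖fderiv ℝ (W s) x‖ₑ ^ 2 ≤ ENNReal.ofReal (K / Real.sqrt (-s)) :=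
    Compactness.law_of_seqLimit (Kinf := K) (Kk := fun _ => K) hψt hvlaw
      (fun ε hε => Eventually.of_forall fun _ => by linarith) hgrad
  have hWsing := Compactness.persistent_singularity_seq (w := fun j => v (ψs j))
    (fun j => hv (ψs j)) (fun j => hvlaw (ψs j)) (fun j => hvsing (ψs j)) hW hunif
  -- ### the trace of `W` is irrotational outside the closed unit ball: `W ≡ 0`, not singular
  have hWz := eq_zero_of_trace_irrotational_farField hW hWlaw (R₁ := 1) fun φ hφ hsupp => by
    have hφ1 : ContDiff ℝ ((⊤ : ℕ∞) + 1) φ := by simpa using hφ.contDiff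
    have hcφ : FunctionSpaces.IsTestFunctionOn (⊤ : Opens (EuclideanSpace ℝ (Fin 3))) (curl φ) :=
      ⟨contDiff_curl hφ1, hasCompactSupport_curl hφ.hasCompactSupport, fun y _ => Opens.mem_top y⟩
    obtain ⟨L, hL⟩ := exists_tendsto_pairing_finalSlice hW hWlaw hcφ
    suffices hL0 : L = 0 by rwa [hL0] at hL
    have hex : ∀ j, ∃ Tj : ℝ, Tendsto (fun t => ∫ x, ⟪v (ψs j) t x, curl φ x⟫) (𝓝[<] 0) (𝓝 Tj) :=
      fun j => exists_tendsto_pairing_finalSlice (hv (ψs j)) (hvlaw (ψs j)) hcφ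
    choose Tj hTj using hex
    have hconv : Tendsto Tj atTop (𝓝 L) :=
      tendsto_trace_of_tendsto_slices hcφ (fun j => hv (ψs j)) (fun j => hvlaw (ψs j)) hW hWlaw
        (fun t ht x => hpt t ht x) hTj hL
    set I : ℝ := ∫ x, ‖φ x‖ / ‖x‖ ^ 2 with hI
    have hbound : ∀ j, |Tj j| ≤ 1 / ((ψs j : ℝ) + 1) * I := fun j =>
      hvsmall (ψs j) φ hφ hsupp (Tj j) (hTj j)
    have hzero : Tendsto Tj atTop (𝓝 0) := by
      have hmaj : Tendsto (fun j => 1 / ((ψs j : ℝ) + 1) * I) atTop (𝓝 0) := by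
        have h1 : Tendsto (fun j => 1 / ((ψs j : ℝ) + 1)) atTop (𝓝 0) := by
          have h2 : Tendsto (fun j => (ψs j : ℝ) + 1) atTop atTop :=
            tendsto_atTop_add_const_right _ _ (tendsto_natCast_atTop_atTop.comp hψt)
          exact tendsto_const_nhds.div_atTop h2
        simpa using h1.mul_const I
      exact squeeze_zero_norm (fun j => by rw [Real.norm_eq_abs]; exact hbound j) hmaj
    exact tendsto_nhds_unique hconv hzero
  obtain ⟨t, ht, x, -, hM⟩ := hWsing 1 one_pos 0
  rw [hWz t ht.2 x, norm_zero] at hM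
  exact lt_irrefl _ hM

/-! ### Portrait: uniform weighted vorticity floors of the final datum of a singular member -/

/-- **PORTRAIT ENTRY (stub `stub_envelopeCriticalLiouville`): the final-time vorticity saturates
`‖x‖⁻²` at the apex.** There is `θ₃ = θ₃(C,K) > 0` such that the final datum of every SINGULAR
member of `𝒟_{C,K}` has, in EVERY ball `B(0, ρ)`, a test field `ψ` with
`|T_u(∇ ∧ ψ)| > θ₃ ∫ ‖ψ‖/‖x‖²`. -/
theorem trace_vorticity_apex_floor_of_singular (C K : ℝ) : ∃ θ₃ > 0,
    ∀ (u : ℝ → EuclideanSpace ℝ (Fin 3) → EuclideanSpace ℝ (Fin 3)),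
      IsTypeIAncientMild C u →
      (∀ s : ℝ, s < 0 → ∫⁻ x, ‖fderiv ℝ (u s) x‖ₑ ^ 2 ≤ ENNReal.ofReal (K / Real.sqrt (-s))) →
      (∀ r > 0, ∀ M : ℝ, ∃ t ∈ Set.Ioo (-(r ^ 2)) (0 : ℝ),
          ∃ x ∈ Metric.ball (0 : EuclideanSpace ℝ (Fin 3)) r, M < ‖u t x‖) →
      ∀ ρ > 0, ∃ (ψ : EuclideanSpace ℝ (Fin 3) → EuclideanSpace ℝ (Fin 3)) (T : ℝ),
        FunctionSpaces.IsTestFunctionOn (⊤ : Opens (EuclideanSpace ℝ (Fin 3))) ψ ∧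
          (∀ x, ψ x ≠ 0 → ‖x‖ < ρ) ∧
          Tendsto (fun t => ∫ x, ⟪u t x, curl ψ x⟫) (𝓝[<] 0) (𝓝 T) ∧
          θ₃ * (∫ x, ‖ψ x‖ / ‖x‖ ^ 2) < |T| := by
  obtain ⟨θ₃, hθ₃, h⟩ := exists_trace_vorticity_theta_apex C K
  refine ⟨θ₃, hθ₃, fun u hu hlaw hsing ρ hρ => ?_⟩
  by_contra hno
  push Not at hno
  exact h u hu hlaw ρ hρ (fun ψ hψ hs T hT => hno ψ T hψ hs hT) hsing

/-- **PORTRAIT ENTRY (stub `stub_envelopeCriticalLiouville`): the final-time vorticity saturates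
`‖x‖⁻²` at infinity.** There is `θ₄ = θ₄(C,K) > 0` such that the final datum of every SINGULAR
member of `𝒟_{C,K}` has, outside EVERY ball `B(0, R)`, a test field `ψ` with
`|T_u(∇ ∧ ψ)| > θ₄ ∫ ‖ψ‖/‖x‖²`. -/
theorem trace_vorticity_farField_floor_of_singular (C K : ℝ) : ∃ θ₄ > 0,
    ∀ (u : ℝ → EuclideanSpace ℝ (Fin 3) → EuclideanSpace ℝ (Fin 3)),
      IsTypeIAncientMild C u →
      (∀ s : ℝ, s < 0 → ∫⁻ x, ‖fderiv ℝ (u s) x‖ₑ ^ 2 ≤ ENNReal.ofReal (K / Real.sqrt (-s))) →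
      (∀ r > 0, ∀ M : ℝ, ∃ t ∈ Set.Ioo (-(r ^ 2)) (0 : ℝ),
          ∃ x ∈ Metric.ball (0 : EuclideanSpace ℝ (Fin 3)) r, M < ‖u t x‖) →
      ∀ R > 0, ∃ (ψ : EuclideanSpace ℝ (Fin 3) → EuclideanSpace ℝ (Fin 3)) (T : ℝ),
        FunctionSpaces.IsTestFunctionOn (⊤ : Opens (EuclideanSpace ℝ (Fin 3))) ψ ∧
          (∀ x, ψ x ≠ 0 → R < ‖x‖) ∧
          Tendsto (fun t => ∫ x, ⟪u t x, curl ψ x⟫) (𝓝[<] 0) (𝓝 T) ∧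
          θ₄ * (∫ x, ‖ψ x‖ / ‖x‖ ^ 2) < |T| := by
  obtain ⟨θ₄, hθ₄, h⟩ := exists_trace_vorticity_theta_atInfinity C K
  refine ⟨θ₄, hθ₄, fun u hu hlaw hsing R hR => ?_⟩
  by_contra hno
  push Not at hno
  exact h u hu hlaw R hR (fun ψ hψ hs T hT => hno ψ T hψ hs hT) hsing

/-- **The crux ⟺ its restriction to members whose final-time vorticity saturates the critical
scale `‖x‖⁻²` at the apex AND at infinity.** -/
theorem finiteDissipationLiouville_iff_vorticityFloors :
    Summit.NavierStokesRegularity.NavierStokesRegularity.Theses.LerayQuarterDissipation.FiniteDissipationLiouville ↔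
      ∀ (C K : ℝ) (u : ℝ → EuclideanSpace ℝ (Fin 3) → EuclideanSpace ℝ (Fin 3)),
        IsTypeIAncientMild C u →
        (∀ s : ℝ, s < 0 → ∫⁻ x, ‖fderiv ℝ (u s) x‖ₑ ^ 2 ≤ ENNReal.ofReal (K / Real.sqrt (-s))) →
        (∃ θ > 0, ∀ ρ > 0, ∃ (ψ : EuclideanSpace ℝ (Fin 3) → EuclideanSpace ℝ (Fin 3)) (T : ℝ),
          FunctionSpaces.IsTestFunctionOn (⊤ : Opens (EuclideanSpace ℝ (Fin 3))) ψ ∧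
            (∀ x, ψ x ≠ 0 → ‖x‖ < ρ) ∧
            Tendsto (fun t => ∫ x, ⟪u t x, curl ψ x⟫) (𝓝[<] 0) (𝓝 T) ∧
            θ * (∫ x, ‖ψ x‖ / ‖x‖ ^ 2) < |T|) →
        (∃ θ > 0, ∀ R > 0, ∃ (ψ : EuclideanSpace ℝ (Fin 3) → EuclideanSpace ℝ (Fin 3)) (T : ℝ),
          FunctionSpaces.IsTestFunctionOn (⊤ : Opens (EuclideanSpace ℝ (Fin 3))) ψ ∧
            (∀ x, ψ x ≠ 0 → R < ‖x‖) ∧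
            Tendsto (fun t => ∫ x, ⟪u t x, curl ψ x⟫) (𝓝[<] 0) (𝓝 T) ∧
            θ * (∫ x, ‖ψ x‖ / ‖x‖ ^ 2) < |T|) →
        ¬ (∀ r > 0, ∀ M : ℝ, ∃ t ∈ Set.Ioo (-(r ^ 2)) (0 : ℝ),
            ∃ x ∈ Metric.ball (0 : EuclideanSpace ℝ (Fin 3)) r, M < ‖u t x‖) := by
  unfold Summit.NavierStokesRegularity.NavierStokesRegularity.Theses.LerayQuarterDissipation.FiniteDissipationLiouville
  constructor
  · intro h C K u hu hlaw _ _
    exact h C K u hu hlaw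
  · intro h C K u hu hlaw hsing
    obtain ⟨θ₃, hθ₃, h₃⟩ := trace_vorticity_apex_floor_of_singular C K
    obtain ⟨θ₄, hθ₄, h₄⟩ := trace_vorticity_farField_floor_of_singular C K
    exact h C K u hu hlaw ⟨θ₃, hθ₃, h₃ u hu hlaw hsing⟩ ⟨θ₄, hθ₄, h₄ u hu hlaw hsing⟩ hsing

end Summit.NavierStokesRegularity.NavierStokesRegularity.Theorems.FiniteDissipationLiouville.Birth.Apex

end
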